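import Summits.CriticalPhenomena.PercolationContinuityZ3.Theorems.PercNearOneGluingNoHeavyQuantFarSunGame
import Mathlib.Tactic.IntervalCases
import HarnessLib

/-!
# FAR beyond trees: REGION II CERTIFICATES (series B, cells matched to the analytic Chernoff ladder), `K = 13`, cells [7/40, 9/40), [9/40, 19/80), [19/80, 1/4)

builds on p205010 (kernel theorem, internal audit signed; external expert review pending)

Support file (`--supports stmt-CriticalPhenomena-4575`), seat `prim-cert-1` (gen 39); memo `prim-cert-1/FROM-prim-cert-1-g39-VERTEX-GAME.md` §0(iv)–(vi), §5.
COMPUTATIONAL (`native_decide`).  Same format as `…QuantFarSunCertCells13` &c.; here the cells `[lo, hi)` for the least hair weight and the first certified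
budget `B_min = ⌊S/u⌋ + 1` are MATCHED to the analytic slab bound `Σh > S` obtained on `R` from the θ = 1/2 Chernoff ladder with quarter-integer rungs
(`1 − F ≤ 4·e^{−Σ/2} ≤ 4·0.7789^{2s}` for `Σ ≥ s`; seat folder work/dpc/ladder2.py, cellplan2.json), so that every vertex word of a configuration's cell box
has a certified budget.  All instances exact-verified nonnegative beforehand (int128 engine).  Consumed by `HairyCycle.witGavg_ge_one_of_cellCert` (…GameAvg).
Elementary [this work]; no sorries; axioms standard + `Lean.ofReduceBool` (native_decide).
-/

namespace Summit.CriticalPhenomena.PercolationContinuityZ3.Theorems.HairyCycle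

/-- Region II certificate (series B) `K = 13`, cell `η ∈ [7/40, 9/40)`: letters `['7/40', '1/2', '3/4', '1']` over `q = 40`, weights `[2, 3, 4, 4]`
(unit `1/4`), caps `(8,2,3)`, `Lpay = 60`; budgets `43 … 52` (ladder bound `Σ > 10.702`). [this work] -/
theorem cellCertB_13_0 : (⟨8, 2, 3, 13, 40, 60, [(7, 2), (20, 3), (30, 4), (40, 4)]⟩ : GameSpec).gameCert 52 13 (List.range' 43 10) = true := by
  native_decide

/-- Its specification is well formed. [this work] -/
theorem cellWFB_13_0 : (⟨8, 2, 3, 13, 40, 60, [(7, 2), (20, 3), (30, 4), (40, 4)]⟩ : GameSpec).WF where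
  q_pos := by decide
  k_le := by
    intro i hi
    have : i < 4 := hi
    interval_cases i <;> decide
  Kcred4 := by decide
  Lpay_pos := by decide
  dvdA := by
    intro d h1 h2
    change d + 4 ≤ 8 at h2
    have h3 : d ≤ 4 := by omega
    interval_cases d <;> decide
  dvdK := by decide

/-- Region II certificate (series B) `K = 13`, cell `η ∈ [9/40, 19/80)`: letters `['9/40', '1/2', '3/4', '1']` over `q = 40`, weights `[2, 3, 4, 4]`
(unit `1/4`), caps `(8,2,3)`, `Lpay = 60`; budgets `41 … 52` (ladder bound `Σ > 10.194`). [this work] -/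
theorem cellCertB_13_1 : (⟨8, 2, 3, 13, 40, 60, [(9, 2), (20, 3), (30, 4), (40, 4)]⟩ : GameSpec).gameCert 52 13 (List.range' 41 12) = true := by
  native_decide

/-- Its specification is well formed. [this work] -/
theorem cellWFB_13_1 : (⟨8, 2, 3, 13, 40, 60, [(9, 2), (20, 3), (30, 4), (40, 4)]⟩ : GameSpec).WF where
  q_pos := by decide
  k_le := by
    intro i hi
    have : i < 4 := hi
    interval_cases i <;> decide
  Kcred4 := by decide
  Lpay_pos := by decide
  dvdA := by
    intro d h1 h2
    change d + 4 ≤ 8 at h2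
    have h3 : d ≤ 4 := by omega
    interval_cases d <;> decide
  dvdK := by decide

/-- Region II certificate (series B) `K = 13`, cell `η ∈ [19/80, 1/4)`: letters `['19/80', '2/5', '3/5', '4/5', '1']` over `q = 80`, weights `[2, 3, 4, 5, 5]`
(unit `1/5`), caps `(8,2,3)`, `Lpay = 60`; budgets `49 … 65` (ladder bound `Σ > 9.722`). [this work] -/
theorem cellCertB_13_2 : (⟨8, 2, 3, 13, 80, 60, [(19, 2), (32, 3), (48, 4), (64, 5), (80, 5)]⟩ : GameSpec).gameCert 65 13 (List.range' 49 17) = true := by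
  native_decide

/-- Its specification is well formed. [this work] -/
theorem cellWFB_13_2 : (⟨8, 2, 3, 13, 80, 60, [(19, 2), (32, 3), (48, 4), (64, 5), (80, 5)]⟩ : GameSpec).WF where
  q_pos := by decide
  k_le := by
    intro i hi
    have : i < 5 := hi
    interval_cases i <;> decide
  Kcred4 := by decide
  Lpay_pos := by decide
  dvdA := by
    intro d h1 h2
    change d + 4 ≤ 8 at h2
    have h3 : d ≤ 4 := by omega
    interval_cases d <;> decide
  dvdK := by decide

end Summit.CriticalPhenomena.PercolationContinuityZ3.Theorems.HairyCycle
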